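import Summits.QuantumFields.BalabanUV.T4Continuum.Support.InsertionChannelEnd
import Summits.QuantumFields.BalabanUV.T4Continuum.Support.B13StepEndArithmetic

/-!
# NE5 ∕ U3 — LEAVES L10 (REACH) ∧ L11 (SMALLNESS) ON THE CHANNEL-READING ROAD, LETTER-FREE: the five arithmetic binders of leaf-06-g2's
# END faces `InsertionChannelEnd.ne5_at_of_stepModel_fibre_{evalChannel,pieceChannelG,pieceChannel}_nat` (p218126) over `ρ₀, k₀, B`
# ELIMINATED, and THE RATE WINDOW IS NON-EMPTY (some target rate `θ′ < 1`) IFF ONE INEQUALITY `c·(G + EA₀ + E₀) < 1 − ω` — at the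
# printed-count letters `(6L)⁴·(G + EA₀ + E₀) < 1 − L⁻¹` (row O6-n NUMERICS follower; the owner's `OutputRateChannelReach` p218640 keeps `ρ₀`)

Cell `pub-balaban`, unit `b2b-balaban-t4-ne5-formalise-leaf-10` (NE5 formalisation swarm, LEAF PROVER 10, gen 6; row O6-n NUMERICS = leaves
L10∕L11 of `SKELETON-NE5-P1`; journal INTENT in `CLAIMS.log` (this gen), CLAIM RULE 1).  Summits-side new work under the LEAN PLACEMENT RULE
(cell bookkeeping; NOT a Literature module; 0 `def`, 0 cite tag); nothing landed is edited — leaf-06-g2's three END faces, this lineage's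
`B13StepEndArithmetic.arithmetic_letters_iff` (N69) and the owner's `OutputRateCount124.smallnessG_count124_iff` are applied BY NAME.
HONEST FRAMING: rung (B)+1 of the FINITE-VOLUME T⁴ continuum programme — NOT infinite volume, NOT a mass gap, NOT the Clay problem, and
**NOT A PROOF OF NE5** (NOT PRINTED; GAPS G-t4-U3-1) nor of NE9: every END below is an IMPLICATION whose wall binders (the reading
`ReadsChannel`, row NE9's `PieceBound`∕`LevelCounts` (S5; NOT printed, NOT proved), the two FIBRE envelopes `OpFibreEnvelope`∕
`HistFibreEnvelope` of constant `G` (W2), W1 `OperatorRate δ θ`, W4 `InsertionRate`, the levels L05∕L06 — [Balaban1987RG1] (1.18) p. 263,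
SHAPE only —, the representation and base binders) are DISPLAYED HYPOTHESES, asserted nowhere.  HONEST DEPENDENCY (cell line, verbatim):
continuum YM on T⁴ ⇐ BetaPertH ∧ nine spine estimates (0/9 proved); BetaPertH ⇐ (D1) ∧ (D4) ∧ CAP+tail; G-an2-4 gates asym, D1 and NE2/3/4.

THE POINT (decls, not adjectives).  On every E1′-type END face the target rate `θ′` must clear `ω + Λ·c` with the Cauchy modulus
`Λ = G∕(1 − ρ₀)` of the fibre envelopes at reach `ρ₀`, while the reach must clear the level term, `c(EA₀ + E₀)∕(1 − ω) < ρ₀ < 1`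
(`hnear` as `k₀ → ∞`).  This lineage's `arithmetic_letters_iff` says the five binders over `ρ₀, k₀, B` are jointly satisfiable iff
`c(EA₀ + E₀) < 1 − ω` and `ω + G·c·(1 − ω)∕(1 − ω − c(EA₀ + E₀)) < θ′`.  Freeing the target rate as well (the owner's census question of
`OutputRateChannelReach` p218640, whose ρ₀-PARAMETRIC face `exists_rate_lt_one_iff` answers `G < (1 − L⁻¹)(1 − ρ₀)∕(6L)⁴` with the
reach letter `ρ₀` kept — owner R40: «cite p218640 as the ρ₀-parametric face») the answer has NO letter left:
**`c·(G + EA₀ + E₀) < 1 − ω`** (`rateWindow_nonempty_iff`; with `u := 1 − ω`, `s := c(EA₀ + E₀)`: `ω + G·c·u∕(u − s) < 1 ⟺ G·c < u − s`).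
At the printed-count letters `c = (6L)⁴`, `ω = L⁻¹` ([Balaban1988RG2Cluster] p. 8 [R] «This yields (6L)⁴Lʲη, and the sum over j is
bounded by 2(6L)⁴» — KIND only, as read by the owner's `OutputRateCount124`, R30 (iii); loci file `b13-loci.md` l.9): **`(6L)⁴·(G + EA₀ + E₀) <
1 − L⁻¹`**, i.e. `G + EA₀ + E₀ < 1∕41472` at `L = 2`, `< 1∕157464` at `L = 3` (§4).  [analysis, not kernel]: `G ~ O(1)C₃ε₁` per history
margin and `EA₀, E₀ ~` the one-run (1.18)-levels in the slice units — an ε₁-AND-E₀-AFTER-L smallness of [II]'s ORDER of constants; every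
letter O(1)-symbolic or not printed ⇒ STILL NO numeric instance (census `B13SmallnessCensus.md`).

WHAT THIS FILE DOES.
* §1 `rateWindow_nonempty_iff` (general profile `c ≥ 0`, damping `ω < 1`, envelope `G ≥ 0`) and `rateWindow_nonempty_count124_iff`
  (`c = (6L)⁴`, `ω = L⁻¹`, `1 < L`): the two strict size inequalities with target rate `1` ⟺ `c·(G + EA₀ + E₀) < 1 − ω`;
  `reach_letters_lt_one_iff` — ANY ROAD: the five binders of `arithmetic_letters_iff` LITERALLY + a free target rate `θ ≤ θ′ < 1` ⟺ the same.
* §2 `channel_letters_count124_iff` — the five arithmetic binders of `ne5_at_of_stepModel_fibre_pieceChannel_nat` LITERALLY (`hρ₀`, `hB`,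
  `hnear` at `(6L)⁴`∕`L⁻¹`, `hfirst`, the `G`-form smallness `G < (θ′ − L⁻¹)(1 − ρ₀)∕(6L)⁴`) ⟺ `(6L)⁴(EA₀ + E₀) < 1 − L⁻¹ ∧ L⁻¹ +
  G·(6L)⁴·(1 − L⁻¹)∕(1 − L⁻¹ − (6L)⁴(EA₀ + E₀)) < θ′`; `channel_reach_count124_iff` — the same with `θ ≤ θ′ < 1` free ⟺
  `(6L)⁴·(G + EA₀ + E₀) < 1 − L⁻¹` (for an input rate `0 < θ < 1`).
* §3 END faces, letters eliminated: `exists_ne5_of_stepModel_fibre_evalChannel_nat` ∕ `…_pieceChannelG_nat` (general profile: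
  `c(EA₀ + E₀) < 1 − ω`, `ω + G·c·(1 − ω)∕(1 − ω − c(EA₀ + E₀)) < θ′` ⟹ `∃ C₅, NE5 EA EB W κ θ′ C₅`) ∕ `…_pieceChannel_nat` (printed-count
  letters); and THE REACH FACES `exists_rate_lt_one_of_stepModel_fibre_pieceChannel_nat'` ∕ `…_pieceChannelG_nat'` ∕ `…_evalChannel_nat'`: for EVERY
  input rate `0 < θ < 1`, `(6L)⁴·(G + EA₀ + E₀) < 1 − L⁻¹` (resp. `cQ·(G + EA₀ + E₀) < 1 − ω`, `c·(G + EA₀ + E₀) < 1 − ω`) ⟹ `∃ θ′ < 1, ∃ C₅,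
  NE5 EA EB W κ θ′ C₅` — the owner's `OutputRateChannelReach.exists_rate_lt_one_of_…` with `ρ₀`, `k₀`, `B`, `hnear`, `hfirst` GONE.
* §4 numerics (`norm_num`): the thresholds `(1 − L⁻¹)∕(6L)⁴ = 1∕41472` (`L = 2`), `= 1∕157464` (`L = 3`).
NOT claimed: any estimate; any value of `G`, `EA₀`, `E₀`; that Bałaban's step satisfies a binder.  0 sorry; axioms ⊆ {propext,
Classical.choice, Quot.sound}.
-/

noncomputable section

open MeasureTheory

namespace Summit.QuantumFields.BalabanUV.T4Continuum.InsertionChannelEndArithmetic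

open Literature.MathematicalPhysics.QuantumFieldTheory.Balaban1983to89
open Literature.MathematicalPhysics.QuantumFieldTheory.Balaban1983to89.T4OutputRate (Carriers Functional DecayBound NE5)
open Literature.MathematicalPhysics.QuantumFieldTheory.Balaban1983to89.T4InputCauchyRateData (StepModel)
open Summit.QuantumFields.BalabanUV.T4Continuum.B13HistDatum (HistFrame Hist)
open Summit.QuantumFields.BalabanUV.T4Continuum.NE9EvaluationChannel (evalChannel)
open Summit.QuantumFields.BalabanUV.T4Continuum.NE9Lemma1Counting (PieceData pieceChannel SrcScale PieceBound LevelCounts weightOf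
  ellPrinted)
open Summit.QuantumFields.BalabanUV.T4Continuum.NE9Lemma1Gain (PieceBoundG LevelCountsG agePow)
open Summit.QuantumFields.BalabanUV.T4Continuum.OutputRateCount124 (count124_pos smallnessG_count124_iff)
open Summit.QuantumFields.BalabanUV.T4Continuum.InsertionChannelReading (ReadsChannel)
open Summit.QuantumFields.BalabanUV.T4Continuum.InsertionChannelEnd (ne5_at_of_stepModel_fibre_evalChannel_nat
  ne5_at_of_stepModel_fibre_pieceChannelG_nat ne5_at_of_stepModel_fibre_pieceChannel_nat)
open Summit.QuantumFields.BalabanUV.T4Continuum.B13StepEndArithmetic (arithmetic_letters_iff reach_elim_iff smallness_of_gain)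
open Summit.QuantumFields.BalabanUV.T4Continuum.OutputRateArithmetic (reach_binders_exists)

/-! ## §1 The rate window is non-empty iff ONE letter-free inequality holds -/

section Window

/-- [folklore] **THE η-RATE WINDOW IS NON-EMPTY IFF `c·(G + EA₀ + E₀) < 1 − ω`.**  For a profile constant `c ≥ 0`, a damping `ω < 1` and
an envelope `G ≥ 0`, the two strict size inequalities of `arithmetic_letters_iff` with the target rate `1` — `c(EA₀ + E₀) < 1 − ω` and
`ω + G·c·(1 − ω)∕(1 − ω − c(EA₀ + E₀)) < 1` — hold iff `c·(G + EA₀ + E₀) < 1 − ω`. -/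
theorem rateWindow_nonempty_iff {c G EA₀ E₀ ω : ℝ} (hω1 : ω < 1) (hc : 0 ≤ c) (hG : 0 ≤ G) :
    (c * (EA₀ + E₀) < 1 - ω ∧ ω + G * c * (1 - ω) / (1 - ω - c * (EA₀ + E₀)) < 1) ↔ c * (G + EA₀ + E₀) < 1 - ω := by
  have hu : 0 < 1 - ω := sub_pos.2 hω1
  have key : c * (G + EA₀ + E₀) = G * c + c * (EA₀ + E₀) := by ring
  have comm : G * c * (1 - ω) = (1 - ω) * (G * c) := by ring
  have hGc : 0 ≤ G * c := mul_nonneg hG hc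
  constructor
  · rintro ⟨hs, ht⟩
    have hus : 0 < 1 - ω - c * (EA₀ + E₀) := sub_pos.2 hs
    have h1 : G * c * (1 - ω) / (1 - ω - c * (EA₀ + E₀)) < 1 - ω := by linarith
    rw [div_lt_iff₀ hus, comm] at h1
    have h3 : G * c < 1 - ω - c * (EA₀ + E₀) := lt_of_mul_lt_mul_left h1 hu.le
    linarith
  · intro h
    have hs : c * (EA₀ + E₀) < 1 - ω := by linarith
    have hus : 0 < 1 - ω - c * (EA₀ + E₀) := sub_pos.2 hs
    refine ⟨hs, ?_⟩
    have h3 : G * c < 1 - ω - c * (EA₀ + E₀) := by linarith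
    have h1 : G * c * (1 - ω) / (1 - ω - c * (EA₀ + E₀)) < 1 - ω := by
      rw [div_lt_iff₀ hus, comm]
      exact mul_lt_mul_of_pos_left h3 hu
    linarith

/-- [folklore] **AT THE PRINTED-COUNT LETTERS `c = (6L)⁴`, `ω = L⁻¹`** (`1 < L`): the rate window is non-empty iff
`(6L)⁴·(G + EA₀ + E₀) < 1 − L⁻¹`. -/
theorem rateWindow_nonempty_count124_iff {L G EA₀ E₀ : ℝ} (hL : 1 < L) (hG : 0 ≤ G) :
    ((6 * L) ^ 4 * (EA₀ + E₀) < 1 - L⁻¹ ∧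
        L⁻¹ + G * (6 * L) ^ 4 * (1 - L⁻¹) / (1 - L⁻¹ - (6 * L) ^ 4 * (EA₀ + E₀)) < 1) ↔
      (6 * L) ^ 4 * (G + EA₀ + E₀) < 1 - L⁻¹ :=
  rateWindow_nonempty_iff (inv_lt_one_of_one_lt₀ hL) (count124_pos (by linarith)).le hG

/-- [folklore] **L10 ∧ L11 WITH THE TARGET RATE FREE, ANY ROAD.**  The five arithmetic binders of every E1′-type END face LITERALLY
(`hρ₀ : ρ₀ < 1`, `hB : 0 ≤ B`, `hnear : D·θ^{k₀} + c(EA₀ + E₀)∕(1 − ω) ≤ ρ₀`, `hfirst : ∀ k < k₀, EA₀ + E₀ ≤ B·θ^k`,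
`hsmall : ω + G∕(1 − ρ₀)·c < θ′` — as in `B13StepEndArithmetic.arithmetic_letters_iff`) together with a free target rate `θ ≤ θ′ < 1` are
jointly satisfiable iff `c·(G + EA₀ + E₀) < 1 − ω` (input-rate constant `D ≥ 0`, input rate `0 < θ < 1`, `G, c ≥ 0`, `ω < 1`). -/
theorem reach_letters_lt_one_iff {D θ c EA₀ E₀ ω G : ℝ} (hD : 0 ≤ D) (hθ0 : 0 < θ) (hθ1 : θ < 1) (hG : 0 ≤ G) (hc : 0 ≤ c)
    (hω1 : ω < 1) :
    (∃ θ' : ℝ, θ ≤ θ' ∧ θ' < 1 ∧ ∃ ρ₀ : ℝ, ∃ k₀ : ℕ, ∃ B : ℝ, ρ₀ < 1 ∧ 0 ≤ B ∧ D * θ ^ k₀ + c * (EA₀ + E₀) / (1 - ω) ≤ ρ₀ ∧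
        (∀ k < k₀, EA₀ + E₀ ≤ B * θ ^ k) ∧ ω + G / (1 - ρ₀) * c < θ') ↔
      c * (G + EA₀ + E₀) < 1 - ω := by
  simp only [arithmetic_letters_iff hD hθ0 hθ1 hG hc hω1]
  rw [← rateWindow_nonempty_iff hω1 hc hG]
  constructor
  · rintro ⟨θ', -, hθ'1, hh, hs⟩
    exact ⟨hh, hs.trans hθ'1⟩
  · rintro ⟨hh, hs⟩
    obtain ⟨θ', h1, h2⟩ := exists_between (max_lt hθ1 hs)
    exact ⟨θ', (le_max_left _ _).trans h1.le, h2, hh, (le_max_right _ _).trans_lt h1⟩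

end Window

/-! ## §2 The five arithmetic binders of the channel-reading END at the printed-count letters -/

section Letters

/-- [folklore] **THE FIVE ARITHMETIC BINDERS OF `ne5_at_of_stepModel_fibre_pieceChannel_nat` ARE JOINTLY SATISFIABLE IFF TWO STRICT
INEQUALITIES HOLD.**  The binders are LITERALLY `hρ₀ : ρ₀ < 1`, `hB : 0 ≤ B`, `hnear : (δ + δ′)·θ^{k₀} + (6L)⁴(EA₀ + E₀)∕(1 − L⁻¹) ≤ ρ₀`,
`hfirst : ∀ k < k₀, EA₀ + E₀ ≤ B·θ^k` and the `G`-form smallness `hsmall : G < (θ′ − L⁻¹)(1 − ρ₀)∕(6L)⁴` (owner R30 (iii)); for an input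
rate `0 < θ < 1`, `D = δ + δ′ ≥ 0`, `G ≥ 0`, `1 < L` they hold for SOME `ρ₀, k₀, B` iff `(6L)⁴(EA₀ + E₀) < 1 − L⁻¹` and
`L⁻¹ + G·(6L)⁴·(1 − L⁻¹)∕(1 − L⁻¹ − (6L)⁴(EA₀ + E₀)) < θ′` (`arithmetic_letters_iff` + `smallnessG_count124_iff`). -/
theorem channel_letters_count124_iff {L D θ G EA₀ E₀ t : ℝ} (hL : 1 < L) (hD : 0 ≤ D) (hθ0 : 0 < θ) (hθ1 : θ < 1) (hG : 0 ≤ G) :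
    (∃ ρ₀ : ℝ, ∃ k₀ : ℕ, ∃ B : ℝ, ρ₀ < 1 ∧ 0 ≤ B ∧ D * θ ^ k₀ + (6 * L) ^ 4 * (EA₀ + E₀) / (1 - L⁻¹) ≤ ρ₀ ∧
        (∀ k < k₀, EA₀ + E₀ ≤ B * θ ^ k) ∧ G < (t - L⁻¹) * (1 - ρ₀) / (6 * L) ^ 4) ↔
      ((6 * L) ^ 4 * (EA₀ + E₀) < 1 - L⁻¹ ∧
        L⁻¹ + G * (6 * L) ^ 4 * (1 - L⁻¹) / (1 - L⁻¹ - (6 * L) ^ 4 * (EA₀ + E₀)) < t) := by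
  have hL0 : 0 < L := by linarith
  rw [← arithmetic_letters_iff hD hθ0 hθ1 hG (count124_pos hL0).le (inv_lt_one_of_one_lt₀ hL)]
  constructor
  · rintro ⟨ρ₀, k₀, B, hρ₀, hB, hnear, hfirst, hs⟩
    exact ⟨ρ₀, k₀, B, hρ₀, hB, hnear, hfirst, (smallnessG_count124_iff hL0 hρ₀).2 hs⟩
  · rintro ⟨ρ₀, k₀, B, hρ₀, hB, hnear, hfirst, hs⟩
    exact ⟨ρ₀, k₀, B, hρ₀, hB, hnear, hfirst, (smallnessG_count124_iff hL0 hρ₀).1 hs⟩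

/-- [folklore] **REACHABILITY OF SOME RATE BELOW `1`, LETTER-FREE.**  For an input rate `0 < θ < 1`: a target rate `θ ≤ θ′ < 1` and letters
`ρ₀, k₀, B` satisfying the five binders of `ne5_at_of_stepModel_fibre_pieceChannel_nat` EXIST iff `(6L)⁴·(G + EA₀ + E₀) < 1 − L⁻¹`. -/
theorem channel_reach_count124_iff {L D θ G EA₀ E₀ : ℝ} (hL : 1 < L) (hD : 0 ≤ D) (hθ0 : 0 < θ) (hθ1 : θ < 1) (hG : 0 ≤ G) :
    (∃ θ' : ℝ, θ ≤ θ' ∧ θ' < 1 ∧ ∃ ρ₀ : ℝ, ∃ k₀ : ℕ, ∃ B : ℝ, ρ₀ < 1 ∧ 0 ≤ B ∧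
        D * θ ^ k₀ + (6 * L) ^ 4 * (EA₀ + E₀) / (1 - L⁻¹) ≤ ρ₀ ∧ (∀ k < k₀, EA₀ + E₀ ≤ B * θ ^ k) ∧
        G < (θ' - L⁻¹) * (1 - ρ₀) / (6 * L) ^ 4) ↔
      (6 * L) ^ 4 * (G + EA₀ + E₀) < 1 - L⁻¹ := by
  simp only [channel_letters_count124_iff hL hD hθ0 hθ1 hG]
  rw [← rateWindow_nonempty_count124_iff hL hG]
  constructor
  · rintro ⟨θ', -, hθ'1, hh, hs⟩
    exact ⟨hh, hs.trans hθ'1⟩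
  · rintro ⟨hh, hs⟩
    obtain ⟨θ', h1, h2⟩ := exists_between (max_lt hθ1 hs)
    exact ⟨θ', (le_max_left _ _).trans h1.le, h2, hh, (le_max_right _ _).trans_lt h1⟩

end Letters

/-! ## §3 The channel-reading END faces with the letters eliminated, and the reach faces -/

variable {C : Carriers} {Bg ι : Type} {Op : Type*} [NormedAddCommGroup Op] [NormedSpace ℂ Op] {F : HistFrame C}
  {M : StepModel C Op (Hist F)} {out : F.Idx → ι} {W : Set (ℕ → ℝ)}

section EndEval

variable {Ω : Type*} [MeasurableSpace Ω] {F₀ : ℕ → (ℕ → ℝ) → ι → Finset C.Dom} {ν : ℕ → (ℕ → ℝ) → ι → C.Dom → Measure Ω}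
  {w : ℕ → (ℕ → ℝ) → ι → C.Dom → Ω → ℝ} {bg : ℕ → (ℕ → ℝ) → ι → C.Dom → Ω → Bg}

/-- [folklore] **NE5 FOR A STEP MODEL READING AN EVALUATION CHANNEL, ARITHMETIC LETTERS ELIMINATED** — leaf-06-g2's
`ne5_at_of_stepModel_fibre_evalChannel_nat` with `hρ₀`∕`hnear`∕`hB`∕`hfirst`∕`hsmall` over `ρ₀, k₀, B` REPLACED by `0 < θ < 1`, `ω < 1` and the
two strict size inequalities; every other binder BY NAME and unchanged.  `∃ C₅, NE5 EA EB W κ θ′ C₅`.  NOT a proof of NE5. -/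
theorem exists_ne5_of_stepModel_fibre_evalChannel_nat {EA : Functional C C.BgA} {EB : Functional C C.BgB}
    {κ G EA₀ E₀ δ δ' θ θ' c ω : ℝ} {wt : ℕ → ι → ℝ} {τ : ℕ → ℕ → ℝ}
    (hrA : M.RepresentsA EA W) (hrB : M.RepresentsB EB W) (hbase : M.InBase EB W) (hopF : M.OpFibreEnvelope W κ G)
    (hhistF : M.HistFibreEnvelope W κ G) (hdA : DecayBound EA W EA₀ κ) (hdB : DecayBound EB W E₀ κ) (hop : M.OperatorRate W δ θ)
    (hins : M.InsertionRate W κ E₀ δ' θ) (hR : ReadsChannel M (evalChannel F₀ ν w bg) out W)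
    (hw : ∀ k s y, ∀ X ∈ F₀ k s y, Integrable (w k s y X) (ν k s y X)) (hF : ∀ k s y, ∀ X ∈ F₀ k s y, C.scale X ≤ k)
    (hmass : ∀ (k j : ℕ) (s : ℕ → ℝ) (y : ι),
      ∑ X ∈ (F₀ k s y).filter (fun X => C.scale X = j), Real.exp (-(κ * C.d X)) * ∫ ω', |w k s y X ω'| ∂(ν k s y X) ≤
        wt k y * τ k j)
    (hwt0 : ∀ k i, 0 ≤ wt k (out i)) (hwt : ∀ k i, wt k (out i) ≤ M.rHist (k + 1) * F.wt i)
    (hτ : ∀ k j, j ≤ k → τ k j ≤ c * ω ^ (k - j)) (hG : 0 ≤ G) (hδ : 0 ≤ δ + δ') (hθ0 : 0 < θ) (hθ1 : θ < 1) (hθθ' : θ ≤ θ')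
    (hθ'1 : θ' ≤ 1) (hc : 0 ≤ c) (hω : 0 < ω) (hω1 : ω < 1) (hh : c * (EA₀ + E₀) < 1 - ω)
    (hsmall : ω + G * c * (1 - ω) / (1 - ω - c * (EA₀ + E₀)) < θ') :
    ∃ C₅, NE5 EA EB W κ θ' C₅ := by
  obtain ⟨ρ₀, hreach, hρ₀, hs⟩ := (reach_elim_iff (mul_nonneg hG hc) hω1).mpr ⟨hh, hsmall⟩
  obtain ⟨k₀, B, hB, hnear, hfirst⟩ := reach_binders_exists hδ hθ0 hθ1 hreach
  exact ⟨_, ne5_at_of_stepModel_fibre_evalChannel_nat hrA hrB hbase hopF hhistF hdA hdB hop hins hR hw hF hmass hwt0 hwt hτ hG hδ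
    hθ0.le hθθ' hθ'1 hc hω hρ₀ hnear hB hfirst (smallness_of_gain hs)⟩

/-- [folklore] **THE REACH FACE FOR AN EVALUATION CHANNEL** (general profile `c`, damping `ω`): for EVERY input rate `0 < θ < 1`,
`c·(G + EA₀ + E₀) < 1 − ω` gives SOME target rate `θ′ < 1` with `∃ C₅, NE5 EA EB W κ θ′ C₅`; no `ρ₀, k₀, B` left. -/
theorem exists_rate_lt_one_of_stepModel_fibre_evalChannel_nat' {EA : Functional C C.BgA} {EB : Functional C C.BgB}
    {κ G EA₀ E₀ δ δ' θ c ω : ℝ} {wt : ℕ → ι → ℝ} {τ : ℕ → ℕ → ℝ}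
    (hrA : M.RepresentsA EA W) (hrB : M.RepresentsB EB W) (hbase : M.InBase EB W) (hopF : M.OpFibreEnvelope W κ G)
    (hhistF : M.HistFibreEnvelope W κ G) (hdA : DecayBound EA W EA₀ κ) (hdB : DecayBound EB W E₀ κ) (hop : M.OperatorRate W δ θ)
    (hins : M.InsertionRate W κ E₀ δ' θ) (hR : ReadsChannel M (evalChannel F₀ ν w bg) out W)
    (hw : ∀ k s y, ∀ X ∈ F₀ k s y, Integrable (w k s y X) (ν k s y X)) (hF : ∀ k s y, ∀ X ∈ F₀ k s y, C.scale X ≤ k)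
    (hmass : ∀ (k j : ℕ) (s : ℕ → ℝ) (y : ι),
      ∑ X ∈ (F₀ k s y).filter (fun X => C.scale X = j), Real.exp (-(κ * C.d X)) * ∫ ω', |w k s y X ω'| ∂(ν k s y X) ≤
        wt k y * τ k j)
    (hwt0 : ∀ k i, 0 ≤ wt k (out i)) (hwt : ∀ k i, wt k (out i) ≤ M.rHist (k + 1) * F.wt i)
    (hτ : ∀ k j, j ≤ k → τ k j ≤ c * ω ^ (k - j)) (hG : 0 ≤ G) (hδ : 0 ≤ δ + δ') (hθ0 : 0 < θ) (hθ1 : θ < 1) (hc : 0 ≤ c)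
    (hω : 0 < ω) (hω1 : ω < 1) (h : c * (G + EA₀ + E₀) < 1 - ω) :
    ∃ θ' : ℝ, θ' < 1 ∧ ∃ C₅, NE5 EA EB W κ θ' C₅ := by
  obtain ⟨hh, hs⟩ := (rateWindow_nonempty_iff hω1 hc hG).2 h
  obtain ⟨θ', h1, h2⟩ := exists_between (max_lt hθ1 hs)
  exact ⟨θ', h2, exists_ne5_of_stepModel_fibre_evalChannel_nat hrA hrB hbase hopF hhistF hdA hdB hop hins hR hw hF hmass hwt0 hwt hτ hG
    hδ hθ0 hθ1 ((le_max_left _ _).trans h1.le) h2.le hc hω hω1 hh ((le_max_right _ _).trans_lt h1)⟩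

end EndEval

section EndPiece

variable {α β γ : Type} {P : PieceData C Bg ι α β γ}

/-- [folklore] **NE5 FOR A STEP MODEL READING THE GAIN-PARAMETRIC PIECE FORM, ARITHMETIC LETTERS ELIMINATED** — leaf-06-g2's
`ne5_at_of_stepModel_fibre_pieceChannelG_nat` with the five binders over `ρ₀, k₀, B` REPLACED by `0 < θ < 1`, `ω < 1` and the two strict
size inequalities (profile `cQ`); every other binder BY NAME.  `∃ C₅, NE5 EA EB W κ θ′ C₅`.  NOT a proof of NE5. -/
theorem exists_ne5_of_stepModel_fibre_pieceChannelG_nat {EA : Functional C C.BgA} {EB : Functional C C.BgB}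
    {κ κ₁ d0 O1 cQ ω G EA₀ E₀ δ δ' θ θ' : ℝ} {Kp : ℕ → ι → ℝ} {gain : ℕ → ℕ → ℝ}
    (hrA : M.RepresentsA EA W) (hrB : M.RepresentsB EB W) (hbase : M.InBase EB W) (hopF : M.OpFibreEnvelope W κ G)
    (hhistF : M.HistFibreEnvelope W κ G) (hdA : DecayBound EA W EA₀ κ) (hdB : DecayBound EB W E₀ κ) (hop : M.OperatorRate W δ θ)
    (hins : M.InsertionRate W κ E₀ δ' θ) (hR : ReadsChannel M (pieceChannel P) out W) (hsrc : SrcScale P)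
    (hPiece : PieceBoundG P κ κ₁ d0 Kp gain) (hLev : LevelCountsG P κ κ₁ O1 cQ gain (agePow ω)) (hKp : ∀ k y, 0 ≤ Kp k y)
    (hO1 : 0 ≤ O1) (hgain : ∀ k j, 0 ≤ gain k j) (hwt : ∀ k i, weightOf P κ₁ d0 O1 Kp k (out i) ≤ M.rHist (k + 1) * F.wt i)
    (hG : 0 ≤ G) (hδ : 0 ≤ δ + δ') (hθ0 : 0 < θ) (hθ1 : θ < 1) (hθθ' : θ ≤ θ') (hθ'1 : θ' ≤ 1) (hcQ : 0 ≤ cQ) (hω : 0 < ω)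
    (hω1 : ω < 1) (hh : cQ * (EA₀ + E₀) < 1 - ω) (hsmall : ω + G * cQ * (1 - ω) / (1 - ω - cQ * (EA₀ + E₀)) < θ') :
    ∃ C₅, NE5 EA EB W κ θ' C₅ := by
  obtain ⟨ρ₀, hreach, hρ₀, hs⟩ := (reach_elim_iff (mul_nonneg hG hcQ) hω1).mpr ⟨hh, hsmall⟩
  obtain ⟨k₀, B, hB, hnear, hfirst⟩ := reach_binders_exists hδ hθ0 hθ1 hreach
  exact ⟨_, ne5_at_of_stepModel_fibre_pieceChannelG_nat hrA hrB hbase hopF hhistF hdA hdB hop hins hR hsrc hPiece hLev hKp hO1 hgain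
    hwt hG hδ hθ0.le hθθ' hθ'1 hcQ hω hρ₀ hnear hB hfirst (smallness_of_gain hs)⟩

/-- [folklore] **THE REACH FACE, GAIN-PARAMETRIC**: for EVERY input rate `0 < θ < 1`, `cQ·(G + EA₀ + E₀) < 1 − ω` gives SOME target rate
`θ′ < 1` (indeed any `θ′` in the open interval above `max θ (ω + G·cQ·(1 − ω)∕(1 − ω − cQ(EA₀ + E₀)))`) with `∃ C₅, NE5 EA EB W κ θ′ C₅` —
the owner's `OutputRateChannelReach.exists_rate_lt_one_of_stepModel_fibre_pieceChannelG_nat` with `ρ₀, k₀, B, hnear, hfirst` GONE. -/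
theorem exists_rate_lt_one_of_stepModel_fibre_pieceChannelG_nat' {EA : Functional C C.BgA} {EB : Functional C C.BgB}
    {κ κ₁ d0 O1 cQ ω G EA₀ E₀ δ δ' θ : ℝ} {Kp : ℕ → ι → ℝ} {gain : ℕ → ℕ → ℝ}
    (hrA : M.RepresentsA EA W) (hrB : M.RepresentsB EB W) (hbase : M.InBase EB W) (hopF : M.OpFibreEnvelope W κ G)
    (hhistF : M.HistFibreEnvelope W κ G) (hdA : DecayBound EA W EA₀ κ) (hdB : DecayBound EB W E₀ κ) (hop : M.OperatorRate W δ θ)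
    (hins : M.InsertionRate W κ E₀ δ' θ) (hR : ReadsChannel M (pieceChannel P) out W) (hsrc : SrcScale P)
    (hPiece : PieceBoundG P κ κ₁ d0 Kp gain) (hLev : LevelCountsG P κ κ₁ O1 cQ gain (agePow ω)) (hKp : ∀ k y, 0 ≤ Kp k y)
    (hO1 : 0 ≤ O1) (hgain : ∀ k j, 0 ≤ gain k j) (hwt : ∀ k i, weightOf P κ₁ d0 O1 Kp k (out i) ≤ M.rHist (k + 1) * F.wt i)
    (hG : 0 ≤ G) (hδ : 0 ≤ δ + δ') (hθ0 : 0 < θ) (hθ1 : θ < 1) (hcQ : 0 ≤ cQ) (hω : 0 < ω) (hω1 : ω < 1)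
    (h : cQ * (G + EA₀ + E₀) < 1 - ω) :
    ∃ θ' : ℝ, θ' < 1 ∧ ∃ C₅, NE5 EA EB W κ θ' C₅ := by
  obtain ⟨hh, hs⟩ := (rateWindow_nonempty_iff hω1 hcQ hG).2 h
  obtain ⟨θ', h1, h2⟩ := exists_between (max_lt hθ1 hs)
  exact ⟨θ', h2, exists_ne5_of_stepModel_fibre_pieceChannelG_nat hrA hrB hbase hopF hhistF hdA hdB hop hins hR hsrc hPiece hLev hKp
    hO1 hgain hwt hG hδ hθ0 hθ1 ((le_max_left _ _).trans h1.le) h2.le hcQ hω hω1 hh ((le_max_right _ _).trans_lt h1)⟩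

/-- [folklore] **NE5 AT THE PRINTED-COUNT LETTERS FOR A STEP MODEL READING THE ℓ⁵-PIECE FORM, ARITHMETIC LETTERS ELIMINATED** — leaf-06-g2's
`ne5_at_of_stepModel_fibre_pieceChannel_nat` with the five binders over `ρ₀, k₀, B` (incl. the `G`-form smallness) REPLACED by `0 < θ < 1` and
the two strict inequalities of `channel_letters_count124_iff`; every other binder BY NAME.  `∃ C₅, NE5 EA EB W κ θ′ C₅`.  NOT a proof of NE5. -/
theorem exists_ne5_of_stepModel_fibre_pieceChannel_nat {EA : Functional C C.BgA} {EB : Functional C C.BgB}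
    {L κ κ₁ d0 O1 G EA₀ E₀ δ δ' θ θ' : ℝ} {Kp : ℕ → ι → ℝ} (hL : 1 < L)
    (hrA : M.RepresentsA EA W) (hrB : M.RepresentsB EB W) (hbase : M.InBase EB W) (hopF : M.OpFibreEnvelope W κ G)
    (hhistF : M.HistFibreEnvelope W κ G) (hdA : DecayBound EA W EA₀ κ) (hdB : DecayBound EB W E₀ κ) (hop : M.OperatorRate W δ θ)
    (hins : M.InsertionRate W κ E₀ δ' θ) (hR : ReadsChannel M (pieceChannel P) out W) (hsrc : SrcScale P)
    (hPiece : PieceBound P κ κ₁ d0 Kp (ellPrinted L)) (hLev : LevelCounts P κ κ₁ O1 L (ellPrinted L))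
    (hKp : ∀ k y, 0 ≤ Kp k y) (hO1 : 0 ≤ O1) (hwt : ∀ k i, weightOf P κ₁ d0 O1 Kp k (out i) ≤ M.rHist (k + 1) * F.wt i)
    (hG : 0 ≤ G) (hδ : 0 ≤ δ + δ') (hθ0 : 0 < θ) (hθ1 : θ < 1) (hθθ' : θ ≤ θ') (hθ'1 : θ' ≤ 1)
    (hh : (6 * L) ^ 4 * (EA₀ + E₀) < 1 - L⁻¹)
    (hsmall : L⁻¹ + G * (6 * L) ^ 4 * (1 - L⁻¹) / (1 - L⁻¹ - (6 * L) ^ 4 * (EA₀ + E₀)) < θ') :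
    ∃ C₅, NE5 EA EB W κ θ' C₅ := by
  obtain ⟨ρ₀, k₀, B, hρ₀, hB, hnear, hfirst, hs⟩ := (channel_letters_count124_iff hL hδ hθ0 hθ1 hG).2 ⟨hh, hsmall⟩
  exact ⟨_, ne5_at_of_stepModel_fibre_pieceChannel_nat hL hrA hrB hbase hopF hhistF hdA hdB hop hins hR hsrc hPiece hLev hKp hO1 hwt hG
    hδ hθ0.le hθθ' hθ'1 hρ₀ hnear hB hfirst hs⟩

/-- [folklore] **THE REACH FACE AT THE PRINTED-COUNT LETTERS**: for EVERY input rate `0 < θ < 1` of W1∕W4,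
`(6L)⁴·(G + EA₀ + E₀) < 1 − L⁻¹` gives SOME target rate `θ′ < 1` with `∃ C₅, NE5 EA EB W κ θ′ C₅` — the owner's
`OutputRateChannelReach.exists_rate_lt_one_of_stepModel_fibre_pieceChannel_nat` with `ρ₀, k₀, B, hnear, hfirst` GONE (no letter left
besides the sizes `L, G, EA₀, E₀`).  NOT a proof of NE5. -/
theorem exists_rate_lt_one_of_stepModel_fibre_pieceChannel_nat' {EA : Functional C C.BgA} {EB : Functional C C.BgB}
    {L κ κ₁ d0 O1 G EA₀ E₀ δ δ' θ : ℝ} {Kp : ℕ → ι → ℝ} (hL : 1 < L)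
    (hrA : M.RepresentsA EA W) (hrB : M.RepresentsB EB W) (hbase : M.InBase EB W) (hopF : M.OpFibreEnvelope W κ G)
    (hhistF : M.HistFibreEnvelope W κ G) (hdA : DecayBound EA W EA₀ κ) (hdB : DecayBound EB W E₀ κ) (hop : M.OperatorRate W δ θ)
    (hins : M.InsertionRate W κ E₀ δ' θ) (hR : ReadsChannel M (pieceChannel P) out W) (hsrc : SrcScale P)
    (hPiece : PieceBound P κ κ₁ d0 Kp (ellPrinted L)) (hLev : LevelCounts P κ κ₁ O1 L (ellPrinted L))
    (hKp : ∀ k y, 0 ≤ Kp k y) (hO1 : 0 ≤ O1) (hwt : ∀ k i, weightOf P κ₁ d0 O1 Kp k (out i) ≤ M.rHist (k + 1) * F.wt i)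
    (hG : 0 ≤ G) (hδ : 0 ≤ δ + δ') (hθ0 : 0 < θ) (hθ1 : θ < 1) (h : (6 * L) ^ 4 * (G + EA₀ + E₀) < 1 - L⁻¹) :
    ∃ θ' : ℝ, θ' < 1 ∧ ∃ C₅, NE5 EA EB W κ θ' C₅ := by
  obtain ⟨hh, hs⟩ := (rateWindow_nonempty_count124_iff hL hG).2 h
  obtain ⟨θ', h1, h2⟩ := exists_between (max_lt hθ1 hs)
  exact ⟨θ', h2, exists_ne5_of_stepModel_fibre_pieceChannel_nat hL hrA hrB hbase hopF hhistF hdA hdB hop hins hR hsrc hPiece hLev hKp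
    hO1 hwt hG hδ hθ0 hθ1 ((le_max_left _ _).trans h1.le) h2.le hh ((le_max_right _ _).trans_lt h1)⟩

end EndPiece

/-! ## §4 Numerics: the letter-free threshold `(1 − L⁻¹)∕(6L)⁴` at `L = 2, 3` -/

/-- [folklore] At `L = 2`: `(1 − L⁻¹)∕(6L)⁴ = 1∕41472` — the reach face needs `G + EA₀ + E₀ < 1∕41472`. -/
example : (1 - (2 : ℝ)⁻¹) / (6 * 2) ^ 4 = 1 / 41472 := by norm_num

/-- [folklore] At `L = 3`: `(1 − L⁻¹)∕(6L)⁴ = 1∕157464`. -/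
example : (1 - (3 : ℝ)⁻¹) / (6 * 3) ^ 4 = 1 / 157464 := by norm_num

/-- [folklore] The reach inequality in threshold form: for `1 < L`, `(6L)⁴·S < 1 − L⁻¹ ↔ S < (1 − L⁻¹)∕(6L)⁴`. -/
theorem reach_count124_threshold_iff {L S : ℝ} (hL : 1 < L) :
    (6 * L) ^ 4 * S < 1 - L⁻¹ ↔ S < (1 - L⁻¹) / (6 * L) ^ 4 := by
  rw [lt_div_iff₀ (count124_pos (by linarith)), mul_comm]

end Summit.QuantumFields.BalabanUV.T4Continuum.InsertionChannelEndArithmetic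

end
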